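import Summits.QuantumFields.YangMills.Theorems.FlatTubeReductionSymmetricCorePairNear
import Summits.QuantumFields.YangMills.Theorems.FlatTubeReductionDressedFixedBeta
import HarnessLib

/-!
# (B-T) AT RATE, FIXED `β`, NEAR-PAIR RATE: `…DressedFixedBeta.dressed_fixed_beta_estimate` with the symmetric rate `η_s` of `…SymmetricCorePairNear` (differenced magnetic remainder:
# `2·stepActionErr t σ` ↦ `N_pl(58752t³ + 1401138t⁴ + 10⁷αt²)` inside `κ₀ = ξ + 120η_s²`; the TAIL exponents keep lane A's `β·stepActionErr t σ`, which only has to be bounded)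
# (route `FlatTubeReduction`, crux K1 `NearFlatRatioLaw` stmt-QuantumFields-24720; seat `ym-line-ftr-p1` g16; rate twin «ratepack»; R2b1 RECORD rung — no summit statement is proved here)

WHY (NOTES g16 «NP-L»).  With this version the relative rate `κ₀` is `o(λ_b²)` for every fibre radius `t = R = K·β^{-1/2}`, `K ≤ polylog(β)` (successor `…RateKappaNear`), so the dressed
(B-T)-rate brick `hT` can be run for the truncated stiff Gaussian profile of radius `β^{-1/2}√(C log β)` that the (B-OD)-rate brick needs (memo `Lines/ratepack-v4-moments-g15.md` §2),
without the moment machine.  The proof is that of `dressed_fixed_beta_estimate` verbatim with `core_pair_symm_dressed_near` for `core_pair_symm_dressed`.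
* ★★★ `dressed_fixed_beta_estimate_near`.
HONEST FRAMING: bookkeeping of landed bricks for a stub of the CONDITIONAL reduction route R2b1; femto rung R2b1 (RECORD label); not infinite volume, not a gap, not Clay.  No defs, no named
facts, no `sorry`.
-/

set_option autoImplicit false

noncomputable section

open MeasureTheory Filter Topology Real
open scoped BigOperators Matrix Quaternion
open Literature.MathematicalPhysics.QuantumFieldTheory
open Literature.MathematicalPhysics.QuantumLattice

namespace Summit.QuantumFields.YangMills.Theorems.FemtoTransferGap.TwoLattice.ConstTube

open Summit.QuantumFields.YangMills.Theorems.FemtoTransferGap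
open Summit.QuantumFields.YangMills.Theorems.FemtoTransferGap.TwoLattice
open Summit.QuantumFields.YangMills.Theorems.FemtoTransferGap.TwoLattice.Avg
open Summit.QuantumFields.YangMills.Theorems.FemtoTransferGap.TwoLattice.Stiff (LinkSpace)
open Summit.QuantumFields.YangMills.Theorems.FemtoTransferGap.TwoLattice.Cov

variable {L : ℕ} [NeZero L]

set_option maxHeartbeats 3200000 in
-- as in `…DressedFixedBeta` (1.6M there): one long case analysis with ~40 opaque abbreviations and a longer rate polynomial; the default budget is exceeded.
/-- ★★★ (NEAR-PAIR RATE VERSION: `η_s` of `…OffMagneticNear`/`…SymmetricCorePairNear`, hypothesis `α ≤ 1/30` added) **(B-T) AT RATE, FIXED `β` — THE DRESSED KERNEL COMPARISON.**  Hypotheses as in lane A's `fixed_beta_estimate` (profile `0 ≤ Ω ≤ 1` colour-blind, supported in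
`{cap-balanced, |v_{e,c}| ≤ t, ‖v̂‖ ≤ R}`; FP radius `ε ≥ 0`, jump core `R₁`, near/far threshold `0 ≤ α ≤ 1`, window `δ`, far threshold `P₀`), plus `0 ≤ t`, the symmetric rate
`η_s ≤ 1` (split radii) and the first-order diagonal rates (`coreEps1 + coreEps2 ≤ 1`, `coreEta ≤ 1`).  Then for all `u, u'` with `orbitDist < δ`, with `𝔉 = fpBOKernel β Ω (fpWeight ε)`,
`F(a,b) = 𝔉(a,b)/K₁^{(L³β)}(a,b)`, `F^c(1,1) = btC`, `t₀ = e^{−β·btMnt + β·E(t,σ)}(∫Ω)²`, `σ = 12L³δ⁴`: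
`|𝔉(u,u') − √F(u,u)√F(u',u')·K₁(u,u')| ≤ κ₀·√F(u,u)√F(u',u')·K₁(u,u') + e^{6L³β}·(e^{3L³βα²}t₀ + 2√t₀·√(9F^c(1,1) + t₀) + e^{−β·btMfar}(∫Ω)² + (9F^c(1,1) + t₀)e^{−L³βα²})`,
`κ₀ = β|E|α²(6t+2T)² + 120η_s²`, `T = 9LR₁ + ε`. [cite: Luscher1983, §3] -/
theorem dressed_fixed_beta_estimate_near {β : ℝ} (hβ : 0 ≤ β) {Ω : LinkSpace L → ℝ} (hΩm : Measurable Ω) (hΩ1 : ∀ x, |Ω x| ≤ 1) (hΩ0 : ∀ x, 0 ≤ Ω x)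
    (hΩinv : ∀ (g : SU2) (x : LinkSpace L), Ω (adL L g x) = Ω x) {δ α t R R₁ ε P₀ : ℝ}
    (hΩt : ∀ v : Edge 3 L → Fin 3 → ℝ, Ω (linkEmbed L v) ≠ 0 → v ∈ capBalancedSet L ∧ (∀ (e : Edge 3 L) (c : Fin 3), |v e c| ≤ t) ∧ ‖linkEmbed L v‖ ≤ R)
    (hδ2 : δ ≤ 1 / 2) (hα0 : 0 ≤ α) (hα1 : α ≤ 1) (hα30 : α ≤ 1 / 30) (hε0 : 0 ≤ ε) (ht0 : 0 ≤ t)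
    (htT : t ≤ 9 * L * R₁ + ε) (hT : 9 * L * R₁ + ε ≤ 1 / 30) (hσ : (L : ℝ) ^ 3 * (12 * δ ^ 4) < 2)
    (hεsum : coreEps1 L β δ (9 * L * R₁ + ε) R + coreEps2 L β δ (9 * L * R₁ + ε) R ((L : ℝ) ^ 3 * (12 * δ ^ 4)) ≤ 1)
    (hηd : coreEta L β δ α (9 * L * R₁ + ε) R (ε * Fintype.card (Site 3 L)) ((L : ℝ) ^ 3 * (12 * δ ^ 4)) ≤ 1)
    (hηs : β * ((Fintype.card (Edge 3 L) : ℝ) * (558 * α ^ 2 * (9 * L * R₁ + ε) ^ 2 + 192 * α * (9 * L * R₁ + ε) ^ 2) + 216 * α * δ * (ε * Fintype.card (Site 3 L))) +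
        β / 2 * (100 * ((L : ℝ) ^ 3 * (12 * δ ^ 4)) * (Fintype.card (Plaquette 3 L × Fin 3) : ℝ) * R ^ 2 + 10080 * α * (Fintype.card (Plaquette 3 L × Fin 3) : ℝ) * R ^ 2 +
          (Fintype.card (Plaquette 3 L) : ℝ) * (58752 * t ^ 3 + 1401138 * t ^ 4 + 10000000 * α * t ^ 2)) ≤ 1)
    (hLa : 18 * L * (Real.sqrt 2 * R + δ) ≤ 1 / 2)
    (hm₁ : 0 ≤ R₁ / 2 - 2 * (Real.sqrt 2 * R + δ) * ε - (2 * Real.sqrt 2 * R + α)) (hm₂ : 0 ≤ 1 / (3 * L) - 4 * (Real.sqrt 2 * R + δ) - (2 * Real.sqrt 2 * R + α))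
    (hP : 3 * L * P₀ < 1) (hP0 : 0 ≤ P₀ - 4 * (Real.sqrt 2 * R + δ) - (2 * Real.sqrt 2 * R + 2 * δ))
    (hJ : 2 * ε * Fintype.card (Site 3 L) * δ + 2 * R ^ 2 + 2 * Real.sqrt 2 * Fintype.card (Site 3 L) * (9 * L * P₀ + ε) * R ≤ Fintype.card (Site 3 L) * (1 - 3 * L * P₀) * α)
    (u u' : GaugeConfig 3 1 SU2) (hu : orbitDist u < δ) (hu' : orbitDist u' < δ) :
    |fpBOKernel L β Ω (fpWeight L ε) u u' -
        Real.sqrt (fpBOKernel L β Ω (fpWeight L ε) u u / transferKernel su2Rep ((L : ℝ) ^ 3 * β) u u) *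
          Real.sqrt (fpBOKernel L β Ω (fpWeight L ε) u' u' / transferKernel su2Rep ((L : ℝ) ^ 3 * β) u' u') * transferKernel su2Rep ((L : ℝ) ^ 3 * β) u u'| ≤
      (β * (Fintype.card (Edge 3 L) : ℝ) * α ^ 2 * (6 * t + 2 * (9 * L * R₁ + ε)) ^ 2 +
          120 * (β * ((Fintype.card (Edge 3 L) : ℝ) * (558 * α ^ 2 * (9 * L * R₁ + ε) ^ 2 + 192 * α * (9 * L * R₁ + ε) ^ 2) + 216 * α * δ * (ε * Fintype.card (Site 3 L))) +
            β / 2 * (100 * ((L : ℝ) ^ 3 * (12 * δ ^ 4)) * (Fintype.card (Plaquette 3 L × Fin 3) : ℝ) * R ^ 2 + 10080 * α * (Fintype.card (Plaquette 3 L × Fin 3) : ℝ) * R ^ 2 +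
              (Fintype.card (Plaquette 3 L) : ℝ) * (58752 * t ^ 3 + 1401138 * t ^ 4 + 10000000 * α * t ^ 2))) ^ 2) *
        (Real.sqrt (fpBOKernel L β Ω (fpWeight L ε) u u / transferKernel su2Rep ((L : ℝ) ^ 3 * β) u u) *
          Real.sqrt (fpBOKernel L β Ω (fpWeight L ε) u' u' / transferKernel su2Rep ((L : ℝ) ^ 3 * β) u' u') * transferKernel su2Rep ((L : ℝ) ^ 3 * β) u u') +
      Real.exp (6 * ((L : ℝ) ^ 3 * β)) *
        (Real.exp (3 * ((L : ℝ) ^ 3 * β) * α ^ 2) * (Real.exp (-(β * btMnt L δ α R R₁ ε) + β * stepActionErr (L := L) t ((L : ℝ) ^ 3 * (12 * δ ^ 4))) *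
              (∫ v, Ω (linkEmbed L v) ∂orthoTransverse L) ^ 2) +
          2 * Real.sqrt (Real.exp (-(β * btMnt L δ α R R₁ ε) + β * stepActionErr (L := L) t ((L : ℝ) ^ 3 * (12 * δ ^ 4))) * (∫ v, Ω (linkEmbed L v) ∂orthoTransverse L) ^ 2) *
            Real.sqrt (9 * btC L β Ω ε R₁ + Real.exp (-(β * btMnt L δ α R R₁ ε) + β * stepActionErr (L := L) t ((L : ℝ) ^ 3 * (12 * δ ^ 4))) * (∫ v, Ω (linkEmbed L v) ∂orthoTransverse L) ^ 2) +
          Real.exp (-(β * btMfar L δ α R ε P₀)) * (∫ v, Ω (linkEmbed L v) ∂orthoTransverse L) ^ 2 +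
          (9 * btC L β Ω ε R₁ + Real.exp (-(β * btMnt L δ α R R₁ ε) + β * stepActionErr (L := L) t ((L : ℝ) ^ 3 * (12 * δ ^ 4))) * (∫ v, Ω (linkEmbed L v) ∂orthoTransverse L) ^ 2) *
            Real.exp (-((L : ℝ) ^ 3 * β * α ^ 2))) := by
  -- opaque abbreviations
  obtain ⟨T, hTdef⟩ : ∃ T : ℝ, T = 9 * L * R₁ + ε := ⟨_, rfl⟩
  obtain ⟨σ, hσdef⟩ : ∃ σ : ℝ, σ = (L : ℝ) ^ 3 * (12 * δ ^ 4) := ⟨_, rfl⟩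
  obtain ⟨Γ, hΓdef⟩ : ∃ Γ : ℝ, Γ = ε * Fintype.card (Site 3 L) := ⟨_, rfl⟩
  rw [← hTdef] at htT hT hεsum hηd hηs
  rw [← hσdef] at hσ hεsum hηd hηs
  rw [← hΓdef] at hηd hηs
  obtain ⟨I, hIdef⟩ : ∃ I : ℝ, I = ∫ v, Ω (linkEmbed L v) ∂orthoTransverse L := ⟨_, rfl⟩
  obtain ⟨C, hCdef⟩ : ∃ C : ℝ, C = btC L β Ω ε R₁ := ⟨_, rfl⟩
  rw [← hTdef, ← hσdef, ← hΓdef, ← hIdef, ← hCdef]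
  obtain ⟨t₀, ht₀def⟩ : ∃ t₀ : ℝ, t₀ = Real.exp (-(β * btMnt L δ α R R₁ ε) + β * stepActionErr (L := L) t σ) * I ^ 2 := ⟨_, rfl⟩
  rw [← ht₀def]
  obtain ⟨κ₀, hκ₀def⟩ : ∃ κ₀ : ℝ, κ₀ = β * (Fintype.card (Edge 3 L) : ℝ) * α ^ 2 * (6 * t + 2 * T) ^ 2 +
      120 * (β * ((Fintype.card (Edge 3 L) : ℝ) * (558 * α ^ 2 * T ^ 2 + 192 * α * T ^ 2) + 216 * α * δ * Γ) +
        β / 2 * (100 * σ * (Fintype.card (Plaquette 3 L × Fin 3) : ℝ) * R ^ 2 + 10080 * α * (Fintype.card (Plaquette 3 L × Fin 3) : ℝ) * R ^ 2 +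
          (Fintype.card (Plaquette 3 L) : ℝ) * (58752 * t ^ 3 + 1401138 * t ^ 4 + 10000000 * α * t ^ 2))) ^ 2 := ⟨_, rfl⟩
  rw [← hκ₀def]
  -- kernels, weights, basic sizes
  have hK : ∀ a b : GaugeConfig 3 1 SU2, 0 < transferKernel su2Rep ((L : ℝ) ^ 3 * β) a b := fun a b => transferKernel_pos _ _ _ _
  have hL1 : (1 : ℝ) ≤ L := by exact_mod_cast NeZero.one_le
  have hB0 : 0 ≤ (L : ℝ) ^ 3 * β := by positivity
  have hWc := measurable_coreWeight (L := L) ε R₁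
  have hWt := measurable_tailWeight (L := L) ε R₁
  have hWf := measurable_fpWeight L ε
  have hWc01 := coreWeight_mem_Icc (L := L) ε R₁
  have hWt01 := tailWeight_mem_Icc (L := L) ε R₁
  have hWf01 := fpWeight_mem_Icc L ε
  have hI0 : 0 ≤ I := by rw [hIdef]; exact integral_nonneg fun v => hΩ0 _
  have hC0 : 0 ≤ C := by
    rw [hCdef]; exact div_nonneg (fpBOKernel_nonneg β hΩm hΩ1 hΩ0 hWc (abs_coreWeight_le ε R₁) (fun g => (hWc01 g).1) 1 1) (hK 1 1).le
  have ht₀0 : 0 ≤ t₀ := by rw [ht₀def]; positivity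
  have hΓ0 : 0 ≤ Γ := by rw [hΓdef]; exact mul_nonneg hε0 (Nat.cast_nonneg _)
  have hσ0 : 0 ≤ σ := by rw [hσdef]; positivity
  have hκ₀0 : 0 ≤ κ₀ := by
    rw [hκ₀def]
    have : 0 ≤ stepActionErr (L := L) t σ := stepActionErr_nonneg ht0
    positivity
  -- window facts
  have hδu : ∀ e : Edge 3 1, ‖su2Quat (u e) - 1‖ ≤ δ := fun e => (norm_su2Quat_sub_one_le_orbitDist u e).trans hu.le
  have hδu' : ∀ e : Edge 3 1, ‖su2Quat (u' e) - 1‖ ≤ δ := fun e => (norm_su2Quat_sub_one_le_orbitDist u' e).trans hu'.le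
  have hδ0 : 0 ≤ δ := (norm_nonneg _).trans (hδu (0, 0))
  have hSa : ∀ a : GaugeConfig 3 1 SU2, (∀ e : Edge 3 1, ‖su2Quat (a e) - 1‖ ≤ δ) → (L : ℝ) ^ 3 * wilsonAction su2Rep a ≤ σ := fun a ha => by
    rw [hσdef]; exact mul_le_mul_of_nonneg_left (wilsonAction_one_site_le a ha) (by positivity : (0 : ℝ) ≤ (L : ℝ) ^ 3)
  have hS := hSa u hδu
  have hS' := hSa u' hδu'
  have ht30 : t ≤ 1 / 30 := htT.trans hT
  -- tube-link bounds on the supports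
  have hv1_of : ∀ v : Edge 3 L → Fin 3 → ℝ, v ∈ capBalancedSet L → ∀ e, ∑ a, v e a ^ 2 ≤ 1 := fun v hv => sum_sq_le_one_of_cap L hv.2
  have ha_of : ∀ (a : GaugeConfig 3 1 SU2), (∀ e : Edge 3 1, ‖su2Quat (a e) - 1‖ ≤ δ) → ∀ v : Edge 3 L → Fin 3 → ℝ, v ∈ capBalancedSet L → Ω (linkEmbed L v) ≠ 0 →
      ∀ e : Edge 3 L, ‖su2Quat (orthoTube L a v e) - 1‖ ≤ Real.sqrt 2 * R + δ :=
    fun a ha v hv hΩv e => (norm_su2Quat_orthoTube_sub_one_le a (hv1_of v hv) e).trans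
      (add_le_add (mul_le_mul_of_nonneg_left (hΩt v hΩv).2.2 (Real.sqrt_nonneg _)) (ha (0, e.2)))
  have hb_of : ∀ (a b : GaugeConfig 3 1 SU2) (v v' : Edge 3 L → Fin 3 → ℝ), v ∈ capBalancedSet L → v' ∈ capBalancedSet L → Ω (linkEmbed L v) ≠ 0 → Ω (linkEmbed L v') ≠ 0 →
      ∀ {d : ℝ}, (∀ k : Fin 3, ‖su2Quat (a (0, k)) - su2Quat (b (0, k))‖ ≤ d) → ∀ e : Edge 3 L, ‖su2Quat (orthoTube L a v e) - su2Quat (orthoTube L b v' e)‖ ≤ 2 * Real.sqrt 2 * R + d :=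
    fun a b v v' hv hv' hΩv hΩv' d hd e => (norm_su2Quat_orthoTube_sub_orthoTube_le a b (hv1_of v hv) (hv1_of v' hv') e).trans (by
      have h1 := mul_le_mul_of_nonneg_left (hΩt v hΩv).2.2 (Real.sqrt_nonneg 2)
      have h2 := mul_le_mul_of_nonneg_left (hΩt v' hΩv').2.2 (Real.sqrt_nonneg 2)
      linarith [hd e.2])
  -- the split and the symbols `F`
  have hsplit := fun a b : GaugeConfig 3 1 SU2 => fpBOKernel_fpWeight_split (L := L) β ε R₁ hΩm hΩ1 a b
  have hFc0 : ∀ a b : GaugeConfig 3 1 SU2, 0 ≤ fpBOKernel L β Ω (coreWeight L ε R₁) a b := fun a b =>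
    fpBOKernel_nonneg β hΩm hΩ1 hΩ0 hWc (abs_coreWeight_le ε R₁) (fun g => (hWc01 g).1) a b
  have hFt0 : ∀ a b : GaugeConfig 3 1 SU2, 0 ≤ fpBOKernel L β Ω (tailWeight L ε R₁) a b := fun a b =>
    fpBOKernel_nonneg β hΩm hΩ1 hΩ0 hWt (abs_tailWeight_le ε R₁) (fun g => (hWt01 g).1) a b
  have hF0 : ∀ a b : GaugeConfig 3 1 SU2, 0 ≤ fpBOKernel L β Ω (fpWeight L ε) a b := fun a b =>
    fpBOKernel_nonneg β hΩm hΩ1 hΩ0 hWf (abs_fpWeight_le L ε) (fun g => (hWf01 g).1) a b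
  -- the gauge core data of `coreWeight`
  have hWcs : ∀ g : Site 3 L → SU2, coreWeight L ε R₁ g ≠ 0 → (∀ x, ‖su2Quat (g x) - 1‖ ≤ T) ∧ ‖∑ x, vecPart (g x)‖ ≤ Γ := by
    intro g hg
    obtain ⟨hcore, hpin⟩ := mem_of_coreWeight_ne_zero hg
    have hjumps : ∀ e : Edge 3 L, ‖su2Quat (g (e.1.shift e.2)) - su2Quat (g e.1)‖ ≤ R₁ := fun e => (hcore e).le
    have hR₁ : 9 * L * R₁ + ε ≤ 1 / 30 := by rw [← hTdef]; exact hT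
    have h3 : 3 * L * R₁ < 1 := by nlinarith
    refine ⟨fun x => by rw [hTdef]; exact norm_su2Quat_sub_one_le_of_jumps (L := L) hjumps h3 hpin x, ?_⟩
    have hpath := norm_su2Quat_sub_base_le (L := L) hjumps
    have hS0 := colourQuatSum_ne_zero_of_near (L := L) h3 hpath
    have hSle : ‖colourQuatSum L g‖ ≤ Fintype.card (Site 3 L) := by
      unfold colourQuatSum
      refine (norm_sum_le _ _).trans ?_
      simp only [norm_su2Quat, Finset.sum_const, Finset.card_univ, nsmul_eq_mul, mul_one, le_refl]
    calc ‖∑ x, vecPart (g x)‖ ≤ ‖colourQuatSum L g - ‖colourQuatSum L g‖ • (1 : ℍ)‖ := norm_sum_vecPart_le g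
      _ ≤ ε * ‖colourQuatSum L g‖ := norm_colourQuatSum_sub_smul_one_le hS0 hpin
      _ ≤ Γ := by rw [hΓdef]; exact mul_le_mul_of_nonneg_left hSle hε0
  -- (i) DIAGONAL SIZES: `F^c(a,a) ≤ 9·C` for `a ∈ {u,u'}` (lane A's first-order sandwich at `(a,a)`)
  have hdiag : ∀ a : GaugeConfig 3 1 SU2, (∀ e : Edge 3 1, ‖su2Quat (a e) - 1‖ ≤ δ) →
      fpBOKernel L β Ω (coreWeight L ε R₁) a a / transferKernel su2Rep ((L : ℝ) ^ 3 * β) a a ≤ 9 * C := by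
    intro a ha
    have hαa : ∀ k : Fin 3, ‖su2Quat (a (0, k)) - su2Quat (a (0, k))‖ ≤ α := fun k => by rw [sub_self, norm_zero]; exact hα0
    have hsand := core_pair_two_sided hβ hΩm hΩ1 hΩ0 hΩinv hWc (abs_coreWeight_le ε R₁) (fun g => (hWc01 g).1) (coreWeight_conj ε R₁) a a
      (fun k => ha (0, k)) hδ2 hαa hα1 htT hT hσ hσ0 (hSa a ha) (hSa a ha)
      (fun v hv => ⟨(hΩt v hv).2.1, (hΩt v hv).2.2⟩) hWcs hεsum
    have h2 := hsand.2
    refine h2.trans ?_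
    have hC' : fpBOKernel L β Ω (coreWeight L ε R₁) 1 1 / transferKernel su2Rep ((L : ℝ) ^ 3 * β) (1 : GaugeConfig 3 1 SU2) 1 = C := by rw [hCdef]; rfl
    rw [hC']
    have he : Real.exp (coreEta L β δ α T R Γ σ) ≤ 3 := (Real.exp_le_exp.mpr hηd).trans (by have := Real.exp_one_lt_d9; linarith)
    have hT0 : 0 ≤ T := ht0.trans htT
    have hE1 := stepActionErr_nonneg (L := L) (σ := σ) hT0
    have hE2 := stepActionErr_nonneg (L := L) (σ := 0) hT0
    have hε1 : 0 ≤ coreEps1 L β δ T R := by unfold coreEps1; positivity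
    have hε2' : 0 ≤ coreEps2 L β δ T R σ := by unfold coreEps2; positivity
    have hε2 : coreEps2 L β δ T R σ ≤ 1 := by linarith
    have hsq : (coreEps1 L β δ T R + coreEps2 L β δ T R σ) ^ 2 ≤ 1 := by nlinarith
    have hfac : 1 + coreEps2 L β δ T R σ + (coreEps1 L β δ T R + coreEps2 L β δ T R σ) ^ 2 ≤ 3 := by linarith
    have hfac0 : 0 ≤ 1 + coreEps2 L β δ T R σ + (coreEps1 L β δ T R + coreEps2 L β δ T R σ) ^ 2 := by positivity
    calc Real.exp (coreEta L β δ α T R Γ σ) * (1 + coreEps2 L β δ T R σ + (coreEps1 L β δ T R + coreEps2 L β δ T R σ) ^ 2) * C ≤ 3 * 3 * C :=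
        mul_le_mul_of_nonneg_right (mul_le_mul he hfac hfac0 (by norm_num)) hC0
      _ = 9 * C := by ring
  -- (ii) TAILS in one-site units: `F^t(a,b) ≤ e^{BΣ‖Δ‖²}·t₀` for near pairs (and `≤ t₀` on the diagonal)
  have htail : ∀ a b : GaugeConfig 3 1 SU2, (∀ e : Edge 3 1, ‖su2Quat (a e) - 1‖ ≤ δ) → (∀ e : Edge 3 1, ‖su2Quat (b e) - 1‖ ≤ δ) →
      (∀ k : Fin 3, ‖su2Quat (a (0, k)) - su2Quat (b (0, k))‖ ≤ α) →
      fpBOKernel L β Ω (tailWeight L ε R₁) a b / transferKernel su2Rep ((L : ℝ) ^ 3 * β) a b ≤ Real.exp ((L : ℝ) ^ 3 * β * ∑ e : Edge 3 1, ‖su2Quat (a e) - su2Quat (b e)‖ ^ 2) * t₀ := by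
    intro a b ha hb hab
    have hk : ∀ (v v' : Edge 3 L → Fin 3 → ℝ) (g : Site 3 L → SU2), v ∈ capBalancedSet L → v' ∈ capBalancedSet L → Ω (linkEmbed L v) ≠ 0 → Ω (linkEmbed L v') ≠ 0 →
        tailWeight L ε R₁ g ≠ 0 → btMnt L δ α R R₁ ε ≤ kinDefect L (orthoTube L a v) (orthoTube L b v') g := by
      intro v v' g hv hv' hΩv hΩv' hg
      obtain ⟨hoff, hpin⟩ := mem_of_tailWeight_ne_zero hg
      have hdef := kinDefect_ge_off_core (orthoTube L a v) (orthoTube L b v') g (ha_of a ha v hv hΩv) (hb_of a b v v' hv hv' hΩv hΩv' hab) hpin hLa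
        (exists_jump_ge_of_not_mem_coreSet hoff) hm₁ hm₂
      unfold btMnt; exact hdef
    have h := fpBOKernel_tail_div_le hβ hΩm hΩ1 hΩ0 hWt hWt01 a b ht30 hσ (hSa a ha) (hSa b hb) (fun v hv => (hΩt v hv).2.1) hk
    rw [ht₀def, hIdef]
    calc _ ≤ _ := h
      _ = _ := by ring
  have htail_diag : ∀ a : GaugeConfig 3 1 SU2, (∀ e : Edge 3 1, ‖su2Quat (a e) - 1‖ ≤ δ) → fpBOKernel L β Ω (tailWeight L ε R₁) a a / transferKernel su2Rep ((L : ℝ) ^ 3 * β) a a ≤ t₀ := by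
    intro a ha
    have h := htail a a ha ha (fun k => by rw [sub_self, norm_zero]; exact hα0)
    simp only [sub_self, norm_zero, ne_eq, OfNat.ofNat_ne_zero, not_false_eq_true, zero_pow, Finset.sum_const_zero, mul_zero, Real.exp_zero, one_mul] at h
    exact h
  -- the one-site quantities
  obtain ⟨Fuu, hFuu⟩ : ∃ x : ℝ, x = fpBOKernel L β Ω (fpWeight L ε) u u / transferKernel su2Rep ((L : ℝ) ^ 3 * β) u u := ⟨_, rfl⟩
  obtain ⟨Fvv, hFvv⟩ : ∃ x : ℝ, x = fpBOKernel L β Ω (fpWeight L ε) u' u' / transferKernel su2Rep ((L : ℝ) ^ 3 * β) u' u' := ⟨_, rfl⟩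
  obtain ⟨Fcuu, hFcuu⟩ : ∃ x : ℝ, x = fpBOKernel L β Ω (coreWeight L ε R₁) u u / transferKernel su2Rep ((L : ℝ) ^ 3 * β) u u := ⟨_, rfl⟩
  obtain ⟨Fcvv, hFcvv⟩ : ∃ x : ℝ, x = fpBOKernel L β Ω (coreWeight L ε R₁) u' u' / transferKernel su2Rep ((L : ℝ) ^ 3 * β) u' u' := ⟨_, rfl⟩
  obtain ⟨K, hKdef⟩ : ∃ x : ℝ, x = transferKernel su2Rep ((L : ℝ) ^ 3 * β) u u' := ⟨_, rfl⟩
  rw [← hFuu, ← hFvv, ← hKdef]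
  have hKpos : 0 < K := by rw [hKdef]; exact hK u u'
  have hK6 : K ≤ Real.exp (6 * ((L : ℝ) ^ 3 * β)) := by
    rw [hKdef]; refine (transferKernel_one_site_le_exp hB0 u u' 0).trans (Real.exp_le_exp.mpr ?_)
    nlinarith [mul_nonneg hB0 (sq_nonneg ‖su2Quat (u (0, 0)) - su2Quat (u' (0, 0))‖)]
  have hFcuu0 : 0 ≤ Fcuu := by rw [hFcuu]; exact div_nonneg (hFc0 u u) (hK u u).le
  have hFcvv0 : 0 ≤ Fcvv := by rw [hFcvv]; exact div_nonneg (hFc0 u' u') (hK u' u').le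
  have hcu : Fcuu ≤ Fuu ∧ Fuu ≤ Fcuu + t₀ := by
    rw [hFuu, hFcuu, hsplit u u, add_div]
    have h1 := div_nonneg (hFt0 u u) (hK u u).le
    have h2 := htail_diag u hδu
    constructor <;> linarith
  have hcv : Fcvv ≤ Fvv ∧ Fvv ≤ Fcvv + t₀ := by
    rw [hFvv, hFcvv, hsplit u' u', add_div]
    have h1 := div_nonneg (hFt0 u' u') (hK u' u').le
    have h2 := htail_diag u' hδu'
    constructor <;> linarith
  have hdu : Fcuu ≤ 9 * C := by rw [hFcuu]; exact hdiag u hδu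
  have hdv : Fcvv ≤ 9 * C := by rw [hFcvv]; exact hdiag u' hδu'
  have hFuu9 : Fuu ≤ 9 * C + t₀ := by linarith [hcu.2]
  have hFvv9 : Fvv ≤ 9 * C + t₀ := by linarith [hcv.2]
  have hFuu0 : 0 ≤ Fuu := hFcuu0.trans hcu.1
  have hFvv0 : 0 ≤ Fvv := hFcvv0.trans hcv.1
  have hsF : Real.sqrt Fuu ≤ Real.sqrt (9 * C + t₀) := Real.sqrt_le_sqrt hFuu9
  have hsF' : Real.sqrt Fvv ≤ Real.sqrt (9 * C + t₀) := Real.sqrt_le_sqrt hFvv9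
  have hss0 : 0 ≤ Real.sqrt Fuu * Real.sqrt Fvv := mul_nonneg (Real.sqrt_nonneg _) (Real.sqrt_nonneg _)
  -- the four tail summands are nonnegative
  have hτ1 : 0 ≤ Real.exp (3 * ((L : ℝ) ^ 3 * β) * α ^ 2) * t₀ := by positivity
  have hτ2 : 0 ≤ 2 * Real.sqrt t₀ * Real.sqrt (9 * C + t₀) := by positivity
  have hτ3 : 0 ≤ Real.exp (-(β * btMfar L δ α R ε P₀)) * I ^ 2 := by positivity
  have hτ4 : 0 ≤ (9 * C + t₀) * Real.exp (-((L : ℝ) ^ 3 * β * α ^ 2)) := by positivity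
  have he6 : 0 ≤ Real.exp (6 * ((L : ℝ) ^ 3 * β)) := (Real.exp_pos _).le
  by_cases hnear : ∀ k : Fin 3, ‖su2Quat (u (0, k)) - su2Quat (u' (0, k))‖ ≤ α
  · -- NEAR PAIR
    -- the symmetric core sandwich
    have hcore := core_pair_symm_dressed_near hβ hΩm hΩ1 hΩ0 hWc (abs_coreWeight_le ε R₁) (fun g => (hWc01 g).1) (coreWeight_inv ε R₁) u u'
      (fun k => hδu (0, k)) (fun k => hδu' (0, k)) hnear hα30 ht0 htT hT hΓ0 hσ hS hS' hΩt hWcs hηs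
    rw [← hFcuu, ← hFcvv, ← hκ₀def, ← hKdef] at hcore
    -- the off-diagonal tail
    have hto : fpBOKernel L β Ω (tailWeight L ε R₁) u u' / K ≤ Real.exp (3 * ((L : ℝ) ^ 3 * β) * α ^ 2) * t₀ := by
      rw [hKdef]
      refine (htail u u' hδu hδu' hnear).trans (mul_le_mul_of_nonneg_right (Real.exp_le_exp.mpr ?_) ht₀0)
      have hs : ∑ e : Edge 3 1, ‖su2Quat (u e) - su2Quat (u' e)‖ ^ 2 ≤ 3 * α ^ 2 := by
        calc ∑ e : Edge 3 1, ‖su2Quat (u e) - su2Quat (u' e)‖ ^ 2 ≤ ∑ _e : Edge 3 1, α ^ 2 :=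
              Finset.sum_le_sum fun e _ => pow_le_pow_left₀ (norm_nonneg _) (by have := hnear e.2; rwa [show ((0 : Site 3 1), e.2) = e from Prod.ext (Subsingleton.elim _ _) rfl] at this) 2
          _ = 3 * α ^ 2 := by rw [Finset.sum_const, Finset.card_univ, card_edge_one]; simp
      have k := mul_le_mul_of_nonneg_left hs hB0
      linarith [k]
    -- `F(u,u') = F^c(u,u') + F^t(u,u')` in `K`-units
    have hFsplit : fpBOKernel L β Ω (fpWeight L ε) u u' = (fpBOKernel L β Ω (coreWeight L ε R₁) u u' / K + fpBOKernel L β Ω (tailWeight L ε R₁) u u' / K) * K := by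
      rw [hsplit u u', ← add_div, div_mul_cancel₀ _ hKpos.ne']
    rw [hFsplit]
    have hsq := sqrt_mul_sqrt_sub_le hFcuu0 hFcvv0 hcu.1 hcv.1 hcu.2 hcv.2
    have hsc0 : 0 ≤ Real.sqrt Fcuu * Real.sqrt Fcvv := mul_nonneg (Real.sqrt_nonneg _) (Real.sqrt_nonneg _)
    have hsc_le : Real.sqrt Fcuu * Real.sqrt Fcvv ≤ Real.sqrt Fuu * Real.sqrt Fvv := mul_le_mul (Real.sqrt_le_sqrt hcu.1) (Real.sqrt_le_sqrt hcv.1) (Real.sqrt_nonneg _) (Real.sqrt_nonneg _)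
    -- assemble in `K`-units
    have hmain : |fpBOKernel L β Ω (coreWeight L ε R₁) u u' / K + fpBOKernel L β Ω (tailWeight L ε R₁) u u' / K - Real.sqrt Fuu * Real.sqrt Fvv| ≤
        κ₀ * (Real.sqrt Fuu * Real.sqrt Fvv) + (Real.exp (3 * ((L : ℝ) ^ 3 * β) * α ^ 2) * t₀ + 2 * Real.sqrt t₀ * Real.sqrt (9 * C + t₀)) := by
      have hxc := abs_le.mp hcore
      have ht' : 0 ≤ fpBOKernel L β Ω (tailWeight L ε R₁) u u' / K := div_nonneg (hFt0 u u') hKpos.le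
      have hsqb : Real.sqrt Fuu * Real.sqrt Fvv - Real.sqrt Fcuu * Real.sqrt Fcvv ≤ 2 * Real.sqrt t₀ * Real.sqrt (9 * C + t₀) := by
        refine hsq.trans ?_
        have k := mul_le_mul_of_nonneg_left (add_le_add hsF hsF') (Real.sqrt_nonneg t₀)
        linarith [k]
      have hk := mul_le_mul_of_nonneg_left hsc_le hκ₀0
      rw [abs_le]; constructor <;> linarith [hxc.1, hxc.2, hsqb, hsc_le, ht', hto, hk]
    have e1 : (fpBOKernel L β Ω (coreWeight L ε R₁) u u' / K + fpBOKernel L β Ω (tailWeight L ε R₁) u u' / K) * K - Real.sqrt Fuu * Real.sqrt Fvv * K =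
        (fpBOKernel L β Ω (coreWeight L ε R₁) u u' / K + fpBOKernel L β Ω (tailWeight L ε R₁) u u' / K - Real.sqrt Fuu * Real.sqrt Fvv) * K := by ring
    rw [e1, abs_mul, abs_of_pos hKpos]
    have hm2 := mul_le_mul_of_nonneg_right hmain hKpos.le
    refine hm2.trans ?_
    have hKt : (Real.exp (3 * ((L : ℝ) ^ 3 * β) * α ^ 2) * t₀ + 2 * Real.sqrt t₀ * Real.sqrt (9 * C + t₀)) * K ≤
        Real.exp (6 * ((L : ℝ) ^ 3 * β)) * (Real.exp (3 * ((L : ℝ) ^ 3 * β) * α ^ 2) * t₀ + 2 * Real.sqrt t₀ * Real.sqrt (9 * C + t₀)) := by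
      rw [mul_comm]; exact mul_le_mul_of_nonneg_right hK6 (by positivity)
    have p3 := mul_nonneg he6 hτ3
    have p4 := mul_nonneg he6 hτ4
    have e2 : (κ₀ * (Real.sqrt Fuu * Real.sqrt Fvv) + (Real.exp (3 * ((L : ℝ) ^ 3 * β) * α ^ 2) * t₀ + 2 * Real.sqrt t₀ * Real.sqrt (9 * C + t₀))) * K =
        κ₀ * (Real.sqrt Fuu * Real.sqrt Fvv * K) + (Real.exp (3 * ((L : ℝ) ^ 3 * β) * α ^ 2) * t₀ + 2 * Real.sqrt t₀ * Real.sqrt (9 * C + t₀)) * K := by ring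
    rw [e2]
    linarith [hKt, p3, p4]
  · -- FAR PAIR
    push Not at hnear
    obtain ⟨k, hk⟩ := hnear
    have hduu' : ∀ k : Fin 3, ‖su2Quat (u (0, k)) - su2Quat (u' (0, k))‖ ≤ 2 * δ := fun k => by
      have := norm_sub_le_norm_sub_add_norm_sub (su2Quat (u (0, k))) 1 (su2Quat (u' (0, k)))
      rw [norm_sub_rev (1 : ℍ)] at this; linarith [hδu (0, k), hδu' (0, k)]
    have hfp : fpBOKernel L β Ω (fpWeight L ε) u u' ≤ Real.exp (6 * ((L : ℝ) ^ 3 * β)) * (Real.exp (-(β * btMfar L δ α R ε P₀)) * I ^ 2) := by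
      have hkb : ∀ (v v' : Edge 3 L → Fin 3 → ℝ) (g : Site 3 L → SU2), v ∈ capBalancedSet L → v' ∈ capBalancedSet L → Ω (linkEmbed L v) ≠ 0 → Ω (linkEmbed L v') ≠ 0 →
          fpWeight L ε g ≠ 0 → transferKernel su2Rep β (orthoTube L u v) (gaugeTransform g (orthoTube L u' v')) ≤
            Real.exp (β * (2 * (Fintype.card (Edge 3 L) : ℝ))) * Real.exp (-(β * btMfar L δ α R ε P₀)) := by
        intro v v' g hv hv' hΩv hΩv' hg
        have hpin := mem_fpBall_of_fpWeight_ne_zero hg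
        have hdef := kinDefect_ge_far u u' hv hv' g (ha_of u hδu v hv hΩv) (hb_of u u' v v' hv hv' hΩv hΩv' hduu') hε0 hpin (fun k => hδu (0, k)) ⟨k, hk.le⟩
          (hΩt v hΩv).2.2 (hΩt v' hΩv').2.2 hP hP0 hJ
        refine (transferKernel_gaugeTransform_le hβ _ _ g).trans ?_
        rw [← Real.exp_add]
        refine Real.exp_le_exp.mpr ?_
        unfold btMfar
        linarith [mul_le_mul_of_nonneg_left hdef hβ]
      have h := fpBOKernel_le_of_kernel_le β hΩm hΩ1 hΩ0 hWf (abs_fpWeight_le L ε) (fun g => (hWf01 g).1) u u' (by positivity) hkb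
      have hW1 := integral_weight_le_one hWf hWf01
      refine h.trans ?_
      rw [exp_two_card_edge, ← hIdef]
      have := mul_le_mul_of_nonneg_left hW1 (by positivity : (0 : ℝ) ≤ Real.exp (6 * ((L : ℝ) ^ 3 * β)) * Real.exp (-(β * btMfar L δ α R ε P₀)) * I ^ 2)
      linarith [this]
    have hKfar : K ≤ Real.exp (6 * ((L : ℝ) ^ 3 * β)) * Real.exp (-((L : ℝ) ^ 3 * β * α ^ 2)) := by
      rw [hKdef, ← Real.exp_add]
      refine (transferKernel_one_site_le_exp hB0 u u' k).trans (Real.exp_le_exp.mpr ?_)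
      have hsq : α ^ 2 ≤ ‖su2Quat (u (0, k)) - su2Quat (u' (0, k))‖ ^ 2 := pow_le_pow_left₀ hα0 hk.le 2
      have k2 := mul_le_mul_of_nonneg_left hsq hB0
      linarith [k2]
    have hgeom : Real.sqrt Fuu * Real.sqrt Fvv ≤ 9 * C + t₀ := by
      calc Real.sqrt Fuu * Real.sqrt Fvv ≤ Real.sqrt (9 * C + t₀) * Real.sqrt (9 * C + t₀) := mul_le_mul hsF hsF' (Real.sqrt_nonneg _) (Real.sqrt_nonneg _)
        _ = 9 * C + t₀ := Real.mul_self_sqrt (by positivity)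
    have hsecond : Real.sqrt Fuu * Real.sqrt Fvv * K ≤ Real.exp (6 * ((L : ℝ) ^ 3 * β)) * ((9 * C + t₀) * Real.exp (-((L : ℝ) ^ 3 * β * α ^ 2))) := by
      calc Real.sqrt Fuu * Real.sqrt Fvv * K ≤ (9 * C + t₀) * (Real.exp (6 * ((L : ℝ) ^ 3 * β)) * Real.exp (-((L : ℝ) ^ 3 * β * α ^ 2))) := mul_le_mul hgeom hKfar hKpos.le (by positivity)
        _ = _ := by ring
    have hfp0 := hF0 u u'
    have hsK0 : 0 ≤ Real.sqrt Fuu * Real.sqrt Fvv * K := mul_nonneg hss0 hKpos.le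
    have p0 := mul_nonneg hκ₀0 hsK0
    have p1 := mul_nonneg he6 hτ1
    have p2 := mul_nonneg he6 hτ2
    rw [abs_le]
    constructor
    · linarith [p0, p1, p2, hsecond, hfp0]
    · linarith [p0, p1, p2, hfp, hsK0]

end Summit.QuantumFields.YangMills.Theorems.FemtoTransferGap.TwoLattice.ConstTube

end
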